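/-
Copyright: cell `pub-ymgap` (HUMAN RULING D-0062), Track A of `YM-PLAN.md`, DAG node N20 (= NE7b); R134 acceleration seat
`pub-ymgap-dag-n20-c` (strategy s1, generation 3), module 10a.  Released under the licence of the surrounding project.
-/
import Summits.QuantumFields.YangMills.Theorems.LangevinControlUVFemtoCurvatureTwoPointCUniformDoublingAll
import Summits.QuantumFields.YangMills.Theorems.LangevinControlUVFemtoCurvatureTwoPointCTorusLowerAxis
import Literature.MathematicalPhysics.QuantumLattice.HeatKernelGroupGaugeProofs
import HarnessLib

/-!
# YM-DAG node N20 (= NE7b), strategy s1, module 10a: towards the RESTRICTED UNIFORM DOUBLING — per-plaquette control around the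
# hyperplane twist, the comb-gauge reduction for gauge-invariant integrands, and ONE-SITE CONCENTRATION `Z₁(t) ≤ 2·Z_{1,ε'}(t)` (`tε' ≥ c`)

Track A of `YM-PLAN.md` (cell `pub-ymgap`, HUMAN RULING D-0062), node **N20** = spine estimate NE7b (`T4WeightBudget.RelWeightBound` — the
cell `pub-balaban`'s OWN estimate, NOT PRINTED in [Bałaban 1983–89], NOT PROVED).  Seat `pub-ymgap-dag-n20-c` (R134, s1), module 10 in three
files (10a `…N20LCSRestrictedDoublingOneSite`, 10b `…N20LCSRestrictedDoublingLower`, 10c `…N20LCSRestrictedDoubling`; modules 8∕9: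
`…Theorems.BalabanUVNodesN20LCSRestrictedRP{,CauchySchwarz}` — reflection positivity and reflection Cauchy–Schwarz of the restricted level-0
state).  Kernel theorems only: 0 `def`, 0 `sorry`, standard axioms; COUNT-NEUTRAL; `--supports` the K3′ item `SpineGivenEndpointR12`
(stmt-QuantumFields-19908) as a helper.  Nothing of Bałaban's is asserted: the objects are the host tree's (`partitionFunction`, `wilsonAction`,
`WilsonRP.plaqRe`, `haarProbability`, the comb gauge `combEdges`∕`combHolonomy`, the hyperplane twist of `TwistLower`), read BY NAME; the
small-field-RESTRICTED partition function `Z_{L,ε}(b) := ∫ e^{−b S(U)}·∏_p 𝟙[N − Re tr r(U_p) ≤ ε] dHaar^{⊗E}(U)` is written INLINE (no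
definition is introduced).

WHY (the three files).  «LCS-j» (`Spine/NE7b/LocalConditionalStability.LocCondStability`) from level 1 on asks local exponential plaquette
moments in the HISTORY TERM's own state, i.e. for the Wilson weight RESTRICTED by the earlier steps' small-field characteristic functions
(modules 1∕6∕7; the seat's `N20-S1-TRIAGE.md` §1, residual (ii)).  The unrestricted rung 0 (`Spine/NE7b/LocalPlaquetteExpMoments`) is
chessboard + convexity + the host's UNIFORM TORUS DOUBLING `Z_L(b∕2) ≤ e^{AL⁴}Z_L(b)` (`TorusGauge.uniformDoubling_all`); for the restricted
state the chessboard inputs are modules 8∕9 and the β-uniform global input is the RESTRICTED doubling `Z_{L,ε}(b∕2) ≤ e^{AL⁴}Z_{L,ε}(b)`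
(`bε ≥ c`) of file 10c.  No monotonicity in the restriction is available in the tree (no FKG for gauge theories), so the β-uniform comparison
must come from the Gaussian localisation itself: the host's lower-bound region (comb gauge, inner links in `δ = b^{−1∕2}`-balls around the
hyperplane twist of the four axis holonomies) lies INSIDE the `ε`-small region as soon as the axis holonomies' six commutator energies are
`≤ ε' = (ε − 16∕b)∕2`, which costs at most a factor `2` of the one-site function once `bε ≥ c(r)`.

WHAT IS PROVED HERE ([folklore]: Haar measure, Chebyshev; the host's comb gauge and twist algebra BY NAME):
* §1 per-plaquette facts on `(ℤ∕L)⁴`: `plaqRe_gaugeTransform`, `smallField_gaugeTransform`, `smallField_eq_ite`, `smallField_nonneg_le_one`,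
  `plaqEnergy_nonneg_of_unitary`, **`plaqEnergy_le_two_mul_add_of_near`** (`A_p(U) ≤ 2A_p(V) + 16δ²` for `δ`-close links — the summand of
  `TwistLower.wilsonAction_le_two_mul_add_of_near`), **`plaqEnergy_twist_le`** (the twist's plaquette energies are one-site commutator
  energies or `0`: `TwistLower.plaquetteHolonomy_twist` + `OneSite.plaquetteHolonomy_eq_commutator`), `plaqEnergy_le_wilsonAction`.
* §2 **`lintegral_eq_lintegral_combGauge`** (the host's comb-gauge reduction `partitionFunction_eq_lintegral_combGauge` for ANY gauge-invariant
  integrand, via `map_combSection_pi_haar`), `measurable_restrictedWeight`, `restrictedPF_eq_lintegral_combGauge`.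
* §4 `restrictedPF_le_partitionFunction`, `restrictedPF_ne_top`, ★ **`oneSite_le_two_mul_restricted`** — there is `c(r) > 0` with
  `Z₁(t) ≤ 2·Z_{1,ε'}(t)` for all `t > 0`, `tε' ≥ c` (`Z₁` the one-site partition function on `(ℤ∕1)⁴` = the commutator weight of four
  holonomies, `Z_{1,ε'}` its restriction to commutator energies `≤ ε'`): Chebyshev against the host's ONE-SITE DOUBLING
  `oneSite_partitionFunction_doubling`.
(§3 and §5–§6 are files 10b∕10c.)

HONEST FRAMING.  Host currency (bare Wilson weight on `GaugeConfig 4 L G`, any compact second-countable `G` with a faithful unitary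
`LatticeRep`), ONE threshold `ε` on ALL plaquettes, `bε ≥ c(r)` (Bałaban's small-field thresholds have `βε_k → ∞`, so the hypothesis is the
regime; for `bε < c` nothing is claimed).  NOT here: the site∕cube chessboard ITERATION for the restricted state (residual (ii)(b)), the
record-level reading (module 7's dictionary transports it), levels `≥ 1` of LCS, residual (i) (domination letter for `avOfRecord`, seat
n20-d), (iv) (A1c).  NE7b NOT PRINTED ∕ NOT PROVED; (α)-instance 0∕1; N20 NOT discharged; typed 28∕28, discharged count untouched; one finite
four-torus at fixed `ε` — NOT ℝ⁴, NOT infinite volume, NOT OS axioms, NOT a mass gap, NOT Clay.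
-/

set_option autoImplicit false

noncomputable section

open scoped Matrix.Norms.Frobenius ENNReal
open MeasureTheory
open Literature.MathematicalPhysics.QuantumFieldTheory
open Summit.QuantumFields.YangMills.Theorems.FreeEnergyLogCoefficient (dimE exists_haar_gball_ge WeakCoupling.sub_re_trace_eq
  haar_setOf_norm_sub_le continuous_norm_rho_sub)
open Summit.QuantumFields.YangMills.Theorems.FemtoCurvatureTwoPoint.DoublingOfRV (card_plaquette)
open Summit.QuantumFields.YangMills.Theorems.FemtoCurvatureTwoPoint.PlaquetteVariance (partitionFunction_toReal_pos)
open Summit.QuantumFields.YangMills.Theorems.FemtoCurvatureTwoPointC (OneSite.partitionFunction_eq_lintegral'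
  OneSite.plaquetteHolonomy_eq_commutator OneSite.wilsonAction_eq_commutatorCost oneSite_partitionFunction_doubling)
open Summit.QuantumFields.YangMills.Theorems.FemtoCurvatureTwoPointC.TorusGauge

namespace Summit.QuantumFields.YangMills.BalabanUVNodes.N20LCSRestrictedDoubling

/-! ## §1 Per-plaquette facts on the host torus `(ℤ∕L)⁴`: gauge invariance, re-centred Gaussian control, the hyperplane twist -/

section Plaquette

variable {G : Type*} [Group G] {N L : ℕ} [NeZero L] (ρ : G →* Matrix (Fin N) (Fin N) ℂ)

omit [NeZero L] in
/-- `Re tr ρ(U_p)` is gauge invariant (the plaquette holonomy is conjugated, `QuantumLattice.plaquetteHolonomy_gaugeTransform`;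
the trace is cyclic). [folklore] -/
theorem plaqRe_gaugeTransform (g : Site 4 L → G) (U : GaugeConfig 4 L G) (p : Plaquette 4 L) :
    WilsonRP.plaqRe ρ (gaugeTransform g U) p = WilsonRP.plaqRe ρ U p := by
  unfold WilsonRP.plaqRe
  rw [Literature.MathematicalPhysics.QuantumLattice.plaquetteHolonomy_gaugeTransform, map_mul, map_mul,
    Matrix.trace_mul_cycle, ← map_mul, inv_mul_cancel, map_one, one_mul]

/-- The all-plaquette small-field characteristic function `∏_p 𝟙[N − Re tr ρ(U_p) ≤ ε]` is gauge invariant. [folklore] -/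
theorem smallField_gaugeTransform (ε : ℝ) (g : Site 4 L → G) (U : GaugeConfig 4 L G) :
    (∏ p : Plaquette 4 L, (if (N : ℝ) - WilsonRP.plaqRe ρ (gaugeTransform g U) p ≤ ε then (1 : ℝ) else 0)) =
      ∏ p : Plaquette 4 L, (if (N : ℝ) - WilsonRP.plaqRe ρ U p ≤ ε then (1 : ℝ) else 0) := by
  simp_rw [plaqRe_gaugeTransform]

open Classical in
/-- The all-plaquette small-field characteristic function is `𝟙[∀ p, N − Re tr ρ(U_p) ≤ ε]`. [folklore] -/
theorem smallField_eq_ite (ε : ℝ) (U : GaugeConfig 4 L G) :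
    (∏ p : Plaquette 4 L, (if (N : ℝ) - WilsonRP.plaqRe ρ U p ≤ ε then (1 : ℝ) else 0)) =
      if ∀ p : Plaquette 4 L, (N : ℝ) - WilsonRP.plaqRe ρ U p ≤ ε then 1 else 0 := by
  rw [Finset.prod_boole]
  simp only [Finset.mem_univ, true_implies]

/-- The small-field characteristic function takes values in `[0, 1]`. [folklore] -/
theorem smallField_nonneg_le_one (ε : ℝ) (U : GaugeConfig 4 L G) :
    0 ≤ (∏ p : Plaquette 4 L, (if (N : ℝ) - WilsonRP.plaqRe ρ U p ≤ ε then (1 : ℝ) else 0)) ∧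
      (∏ p : Plaquette 4 L, (if (N : ℝ) - WilsonRP.plaqRe ρ U p ≤ ε then (1 : ℝ) else 0)) ≤ 1 := by
  classical
  rw [smallField_eq_ite]
  split_ifs <;> norm_num

omit [NeZero L] in
/-- For a unitary `ρ`, every plaquette energy `N − Re tr ρ(U_p)` is non-negative (`N − Re tr ρ g = ‖1 − ρ g‖²∕2`). [folklore] -/
theorem plaqEnergy_nonneg_of_unitary (hU : ∀ g, ρ g ∈ Matrix.unitaryGroup (Fin N) ℂ) (U : GaugeConfig 4 L G)
    (p : Plaquette 4 L) : 0 ≤ (N : ℝ) - WilsonRP.plaqRe ρ U p := by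
  unfold WilsonRP.plaqRe
  rw [WeakCoupling.sub_re_trace_eq ρ hU]
  positivity

omit [NeZero L] in
/-- **RE-CENTRED GAUSSIAN CONTROL, PER PLAQUETTE**: if every link of `U` is `δ`-close through the unitary `ρ` to the corresponding
link of `V`, then `N − Re tr ρ(U_p) ≤ 2·(N − Re tr ρ(V_p)) + 16 δ²` for EVERY plaquette `p` (the summand of the host tree's
`TwistLower.wilsonAction_le_two_mul_add_of_near`: the holonomy moves by `≤ 4δ`, `TwistLower.norm_rho_plaquetteHolonomy_sub_le`, and
`N − Re tr ρ g ≤ 2(N − Re tr ρ h) + ‖ρ g − ρ h‖²`, `TwistLower.sub_re_trace_le_two_mul_add`). [folklore] -/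
theorem plaqEnergy_le_two_mul_add_of_near (hU : ∀ g, ρ g ∈ Matrix.unitaryGroup (Fin N) ℂ)
    {U V : GaugeConfig 4 L G} {δ : ℝ} (hUV : ∀ e, ‖ρ (U e) - ρ (V e)‖ ≤ δ) (p : Plaquette 4 L) :
    (N : ℝ) - WilsonRP.plaqRe ρ U p ≤ 2 * ((N : ℝ) - WilsonRP.plaqRe ρ V p) + 16 * δ ^ 2 := by
  have h1 := TwistLower.sub_re_trace_le_two_mul_add ρ hU (plaquetteHolonomy U p.1 p.2.1.1 p.2.1.2)
    (plaquetteHolonomy V p.1 p.2.1.1 p.2.1.2)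
  have h2 := TwistLower.norm_rho_plaquetteHolonomy_sub_le ρ hU hUV p.1 p.2.1.1 p.2.1.2
  have h3 : ‖ρ (plaquetteHolonomy U p.1 p.2.1.1 p.2.1.2) - ρ (plaquetteHolonomy V p.1 p.2.1.1 p.2.1.2)‖ ^ 2 ≤
      (4 * δ) ^ 2 := pow_le_pow_left₀ (norm_nonneg _) h2 2
  unfold WilsonRP.plaqRe
  nlinarith [h1, h3]

omit [NeZero L] in
/-- **THE PLAQUETTES OF THE HYPERPLANE TWIST ARE ONE-SITE PLAQUETTES**: for the background `Ū(a)` of a quadruple `a : Fin 4 → G` (the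
host's `TwistLower`: `a_μ` on the last slice `x_μ = L − 1`, `1` elsewhere), every plaquette holonomy is a commutator `[a_μ, a_ν]` or `1`
(`TwistLower.plaquetteHolonomy_twist`), i.e. a plaquette holonomy of the ONE-SITE configuration `(0, μ) ↦ a_μ` of `(ℤ∕1)⁴`
(`OneSite.plaquetteHolonomy_eq_commutator`) or trivial; hence if all six one-site plaquette energies are `≤ ε'`, so is every
plaquette energy of `Ū(a)` (unitary `ρ`). [folklore] -/
theorem plaqEnergy_twist_le (hU : ∀ g, ρ g ∈ Matrix.unitaryGroup (Fin N) ℂ) (a : Fin 4 → G) {Ubar : GaugeConfig 4 L G}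
    (hUbar : ∀ e : Edge 4 L, Ubar e = if (e.1 e.2).val + 1 < L then 1 else a e.2) {ε' : ℝ}
    (hV : ∀ q : Plaquette 4 1, (N : ℝ) - WilsonRP.plaqRe ρ (fun e' : Edge 4 1 => a e'.2) q ≤ ε') (p : Plaquette 4 L) :
    (N : ℝ) - WilsonRP.plaqRe ρ Ubar p ≤ ε' := by
  have hq := hV ((0 : Site 4 1), p.2)
  have hε' : 0 ≤ ε' := (plaqEnergy_nonneg_of_unitary ρ hU _ _).trans hq
  unfold WilsonRP.plaqRe at hq ⊢
  rw [OneSite.plaquetteHolonomy_eq_commutator] at hq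
  rw [TwistLower.plaquetteHolonomy_twist a hUbar p.1 p.2.2.ne]
  split_ifs
  · exact hq
  · simp only [map_one, Matrix.trace_one, Fintype.card_fin, Complex.natCast_re, sub_self]
    exact hε'

/-- A single plaquette energy is at most the Wilson action (all plaquette energies are non-negative for a unitary `ρ`). [folklore] -/
theorem plaqEnergy_le_wilsonAction (hU : ∀ g, ρ g ∈ Matrix.unitaryGroup (Fin N) ℂ) (U : GaugeConfig 4 L G)
    (q : Plaquette 4 L) :
    (N : ℝ) - WilsonRP.plaqRe ρ U q ≤ wilsonAction ρ U := by
  show (N : ℝ) - WilsonRP.plaqRe ρ U q ≤ ∑ p : Plaquette 4 L, ((N : ℝ) - WilsonRP.plaqRe ρ U p)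
  exact Finset.single_le_sum (f := fun p : Plaquette 4 L => (N : ℝ) - WilsonRP.plaqRe ρ U p)
    (fun p _ => plaqEnergy_nonneg_of_unitary ρ hU U p) (Finset.mem_univ q)

end Plaquette

/-! ## §2 The comb-gauge reduction for gauge-invariant integrands; the restricted partition function in the comb gauge -/

section CombGauge

variable {G : Type} [Group G] [TopologicalSpace G] [IsTopologicalGroup G] [CompactSpace G] [MeasurableSpace G]
  [BorelSpace G] [SecondCountableTopology G]

/-- **COMB-GAUGE REDUCTION FOR A GAUGE-INVARIANT INTEGRAND**: if a measurable `Φ ≥ 0` on configurations of `(ℤ∕L)⁴` is invariant under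
the comb gauge transformation `U ↦ U^{H(U)}`, then `∫ Φ dHaar^{⊗E} = ∫_{G^{combᶜ}} Φ(ext W) dHaar^{⊗combᶜ}(W)`, `ext W` the extension of
`W` by `1` on the comb tree (the host's `partitionFunction_eq_lintegral_combGauge` for `Φ = e^{−βS}`, same proof: the law of the gauge-fixed
off-comb links is product Haar, `map_combSection_pi_haar`). [folklore] -/
theorem lintegral_eq_lintegral_combGauge {L : ℕ} [NeZero L] {Φ : GaugeConfig 4 L G → ℝ≥0∞} (hΦ : Measurable Φ)
    (hinv : ∀ U : GaugeConfig 4 L G, Φ (gaugeTransform (combHolonomy U) U) = Φ U) :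
    ∫⁻ U, Φ U ∂(Measure.pi fun _ : Edge 4 L => haarProbability G) =
      ∫⁻ W, Φ (fun e : Edge 4 L => if h : e ∈ combEdges L then (1 : G) else W ⟨e, h⟩)
        ∂(Measure.pi fun _ : {e : Edge 4 L // e ∉ combEdges L} => haarProbability G) := by
  have hfun : ∀ U : GaugeConfig 4 L G, (fun e : Edge 4 L => if h : e ∈ combEdges L then (1 : G) else
      (fun (e' : {e : Edge 4 L // e ∉ combEdges L}) =>
        combHolonomy U e'.1.1 * U e'.1 * (combHolonomy U (e'.1.1.shift e'.1.2))⁻¹) ⟨e, h⟩) =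
      gaugeTransform (combHolonomy U) U := by
    intro U
    funext e
    by_cases he : e ∈ combEdges L
    · rw [dif_pos he, gaugeTransform_combHolonomy_of_mem U he]
    · rw [dif_neg he]
      rfl
  calc ∫⁻ U, Φ U ∂(Measure.pi fun _ : Edge 4 L => haarProbability G)
      = ∫⁻ U, Φ (fun e : Edge 4 L => if h : e ∈ combEdges L then (1 : G) else
          (fun (e' : {e : Edge 4 L // e ∉ combEdges L}) =>
            combHolonomy U e'.1.1 * U e'.1 * (combHolonomy U (e'.1.1.shift e'.1.2))⁻¹) ⟨e, h⟩)
          ∂(Measure.pi fun _ : Edge 4 L => haarProbability G) := by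
        refine lintegral_congr fun U => ?_
        rw [hfun U, hinv U]
    _ = ∫⁻ W, Φ (fun e : Edge 4 L => if h : e ∈ combEdges L then (1 : G) else W ⟨e, h⟩)
        ∂((Measure.pi fun _ : Edge 4 L => haarProbability G).map
          (fun (U : GaugeConfig 4 L G) (e : {e : Edge 4 L // e ∉ combEdges L}) =>
            combHolonomy U e.1.1 * U e.1 * (combHolonomy U (e.1.1.shift e.1.2))⁻¹)) :=
        (lintegral_map (hΦ.comp measurable_combExtend) measurable_combSection).symm
    _ = _ := by rw [map_combSection_pi_haar]

omit [CompactSpace G] [SecondCountableTopology G] in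
/-- Measurability of the small-field-restricted Boltzmann weight `U ↦ e^{−bS(U)}·∏_p 𝟙[N − Re tr ρ(U_p) ≤ ε]` (as an extended
non-negative real). [folklore] -/
theorem measurable_restrictedWeight {N L : ℕ} [NeZero L] (ρ : G →* Matrix (Fin N) (Fin N) ℂ) (hρ : Continuous ρ) (b ε : ℝ) :
    Measurable fun U : GaugeConfig 4 L G => ENNReal.ofReal (Real.exp (-b * wilsonAction ρ U) *
      ∏ p : Plaquette 4 L, (if (N : ℝ) - WilsonRP.plaqRe ρ U p ≤ ε then (1 : ℝ) else 0)) := by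
  refine ENNReal.measurable_ofReal.comp ((Real.measurable_exp.comp
    ((WilsonRP.measurable_wilsonAction ρ hρ).const_mul _)).mul (Finset.measurable_prod _ fun p _ => ?_))
  exact Measurable.ite (measurableSet_le (measurable_const.sub (WilsonRP.measurable_plaqRe ρ hρ p)) measurable_const)
    measurable_const measurable_const

/-- **THE RESTRICTED PARTITION FUNCTION IN THE COMB GAUGE**: `Z_ε(b) := ∫ e^{−bS}·∏_p 𝟙[N − Re tr ρ(U_p) ≤ ε] dHaar^{⊗E}` equals the same
integral over the off-comb links of the extension by `1` (the weight is gauge invariant: `wilsonAction_gaugeTransform`,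
`smallField_gaugeTransform`). [folklore] -/
theorem restrictedPF_eq_lintegral_combGauge {N L : ℕ} [NeZero L] (ρ : G →* Matrix (Fin N) (Fin N) ℂ) (hρ : Continuous ρ)
    (b ε : ℝ) :
    ∫⁻ U : GaugeConfig 4 L G, ENNReal.ofReal (Real.exp (-b * wilsonAction ρ U) *
        ∏ p : Plaquette 4 L, (if (N : ℝ) - WilsonRP.plaqRe ρ U p ≤ ε then (1 : ℝ) else 0))
        ∂(Measure.pi fun _ : Edge 4 L => haarProbability G) =
      ∫⁻ W, ENNReal.ofReal (Real.exp (-b * wilsonAction ρ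
            (fun e : Edge 4 L => if h : e ∈ combEdges L then (1 : G) else W ⟨e, h⟩)) *
          ∏ p : Plaquette 4 L, (if (N : ℝ) - WilsonRP.plaqRe ρ
            (fun e : Edge 4 L => if h : e ∈ combEdges L then (1 : G) else W ⟨e, h⟩) p ≤ ε then (1 : ℝ) else 0))
        ∂(Measure.pi fun _ : {e : Edge 4 L // e ∉ combEdges L} => haarProbability G) :=
  lintegral_eq_lintegral_combGauge (measurable_restrictedWeight ρ hρ b ε) fun U => by
    rw [wilsonAction_gaugeTransform, smallField_gaugeTransform]

end CombGauge

/-! ## §4 One-site concentration: the restricted one-site function is at least half the one-site partition function -/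

section OneSite

variable {G : Type} [Group G] [TopologicalSpace G] [IsTopologicalGroup G] [CompactSpace G] [MeasurableSpace G]
  [BorelSpace G]

/-- The restricted partition function is at most the partition function (the characteristic function is `≤ 1`); in particular it
is finite. [folklore] -/
theorem restrictedPF_le_partitionFunction {L : ℕ} [NeZero L] (r : LatticeRep G) (b ε : ℝ) :
    ∫⁻ U : GaugeConfig 4 L G, ENNReal.ofReal (Real.exp (-b * wilsonAction r.ρ U) *
        ∏ p : Plaquette 4 L, (if (r.N : ℝ) - WilsonRP.plaqRe r.ρ U p ≤ ε then (1 : ℝ) else 0))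
        ∂(Measure.pi fun _ : Edge 4 L => haarProbability G) ≤
      partitionFunction (d := 4) (L := L) r.ρ b := by
  rw [OneSite.partitionFunction_eq_lintegral']
  refine lintegral_mono fun U => ENNReal.ofReal_le_ofReal ?_
  have h := smallField_nonneg_le_one r.ρ ε U
  nlinarith [Real.exp_pos (-b * wilsonAction r.ρ U), h.1, h.2]

/-- The restricted partition function is finite. [folklore] -/
theorem restrictedPF_ne_top {L : ℕ} [NeZero L] (r : LatticeRep G) (b ε : ℝ) :
    ∫⁻ U : GaugeConfig 4 L G, ENNReal.ofReal (Real.exp (-b * wilsonAction r.ρ U) *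
        ∏ p : Plaquette 4 L, (if (r.N : ℝ) - WilsonRP.plaqRe r.ρ U p ≤ ε then (1 : ℝ) else 0))
        ∂(Measure.pi fun _ : Edge 4 L => haarProbability G) ≠ ⊤ := by
  have hZ := partitionFunction_toReal_pos (d := 4) (L := L) r.ρ r.continuous b
  exact ne_top_of_le_ne_top (ENNReal.toReal_pos_iff.1 hZ).2.ne (restrictedPF_le_partitionFunction r b ε)

/-- **ONE-SITE CONCENTRATION.**  There is `c = c(r) > 0` such that for every temperature `t > 0` and threshold `ε'` with `tε' ≥ c`:
`Z₁(t) ≤ 2·Z_{1,ε'}(t)` — the one-site partition function (the commutator weight of four holonomies on `(ℤ∕1)⁴`) loses at most a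
factor `2` when its six commutator energies are restricted to `≤ ε'`.  Chebyshev against the host's ONE-SITE DOUBLING
(`oneSite_partitionFunction_doubling`: `Z₁(t∕4) ≤ K·Z₁(t)`): off the restricted region the action exceeds `ε'`, so
`1 − ∏𝟙 ≤ e^{(3t∕4)(S − ε')}` and `Z₁(t) − Z_{1,ε'}(t) ≤ e^{−3tε'∕4}·Z₁(t∕4) ≤ e^{−3tε'∕4}K·Z₁(t) ≤ ½Z₁(t)` once `3tε'∕4 ≥ log 2K`. [folklore] -/
theorem oneSite_le_two_mul_restricted (r : LatticeRep G) :
    ∃ c : ℝ, 0 < c ∧ ∀ (t ε' : ℝ), 0 < t → c ≤ t * ε' →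
      (partitionFunction (d := 4) (L := 1) r.ρ t).toReal ≤
        2 * (∫⁻ V : GaugeConfig 4 1 G, ENNReal.ofReal (Real.exp (-t * wilsonAction r.ρ V) *
            ∏ q : Plaquette 4 1, (if (r.N : ℝ) - WilsonRP.plaqRe r.ρ V q ≤ ε' then (1 : ℝ) else 0))
          ∂(Measure.pi fun _ : Edge 4 1 => haarProbability G)).toReal := by
  classical
  obtain ⟨K₀, hK₀⟩ := oneSite_partitionFunction_doubling G r
  set K : ℝ := max K₀ 1 with hKdef
  have hK1 : 1 ≤ K := le_max_right _ _
  have hKd : ∀ t : ℝ, 0 < t → (partitionFunction (d := 4) (L := 1) r.ρ (t / 4)).toReal ≤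
      K * (partitionFunction (d := 4) (L := 1) r.ρ t).toReal := fun t ht =>
    (hK₀ t ht).trans (mul_le_mul_of_nonneg_right (le_max_left _ _) ENNReal.toReal_nonneg)
  have hlog : 0 < Real.log (2 * K) := Real.log_pos (by linarith)
  refine ⟨4 / 3 * Real.log (2 * K), by positivity, fun t ε' ht hc => ?_⟩
  set μ : Measure (GaugeConfig 4 1 G) := Measure.pi fun _ : Edge 4 1 => haarProbability G with hμ
  set D : GaugeConfig 4 1 G → ℝ := fun V =>
    ∏ q : Plaquette 4 1, (if (r.N : ℝ) - WilsonRP.plaqRe r.ρ V q ≤ ε' then (1 : ℝ) else 0) with hD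
  -- pointwise: `e^{−tS} ≤ e^{−tS}·D + e^{−3tε'∕4}·e^{−(t∕4)S}`
  have hpt : ∀ V : GaugeConfig 4 1 G, ENNReal.ofReal (Real.exp (-t * wilsonAction r.ρ V)) ≤
      ENNReal.ofReal (Real.exp (-t * wilsonAction r.ρ V) * D V) +
        ENNReal.ofReal (Real.exp (-(3 / 4 * (t * ε')))) * ENNReal.ofReal (Real.exp (-(t / 4) * wilsonAction r.ρ V)) := by
    intro V
    by_cases hDV : ∀ q : Plaquette 4 1, (r.N : ℝ) - WilsonRP.plaqRe r.ρ V q ≤ ε'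
    · have h1 : D V = 1 := Finset.prod_eq_one fun q _ => if_pos (hDV q)
      rw [h1, mul_one]
      exact le_self_add
    · obtain ⟨q, hq⟩ := not_forall.1 hDV
      have h0 : D V = 0 := Finset.prod_eq_zero (Finset.mem_univ q) (if_neg hq)
      rw [h0, mul_zero, ENNReal.ofReal_zero, zero_add, ← ENNReal.ofReal_mul (Real.exp_pos _).le, ← Real.exp_add]
      refine ENNReal.ofReal_le_ofReal (Real.exp_le_exp.2 ?_)
      have hS : ε' < wilsonAction r.ρ V := (not_le.1 hq).trans_le (plaqEnergy_le_wilsonAction r.ρ r.mem_unitary V q)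
      nlinarith
  -- integrate: `Z₁(t) ≤ Z_{1,ε'}(t) + e^{−3tε'∕4}·Z₁(t∕4)`
  have hmeasD := measurable_restrictedWeight (G := G) (L := 1) r.ρ r.continuous t ε'
  have hmeas4 : Measurable fun V : GaugeConfig 4 1 G => ENNReal.ofReal (Real.exp (-(t / 4) * wilsonAction r.ρ V)) :=
    ENNReal.measurable_ofReal.comp (Real.measurable_exp.comp ((WilsonRP.measurable_wilsonAction r.ρ r.continuous).const_mul _))
  have hZ : partitionFunction (d := 4) (L := 1) r.ρ t ≤
      (∫⁻ V, ENNReal.ofReal (Real.exp (-t * wilsonAction r.ρ V) * D V) ∂μ) +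
        ENNReal.ofReal (Real.exp (-(3 / 4 * (t * ε')))) * partitionFunction (d := 4) (L := 1) r.ρ (t / 4) := by
    rw [OneSite.partitionFunction_eq_lintegral', OneSite.partitionFunction_eq_lintegral', ← hμ,
      ← lintegral_const_mul _ hmeas4, ← lintegral_add_left hmeasD]
    exact lintegral_mono hpt
  -- pass to real numbers
  have hZt := partitionFunction_toReal_pos (d := 4) (L := 1) r.ρ r.continuous t
  have hZt_top : partitionFunction (d := 4) (L := 1) r.ρ t ≠ ⊤ := (ENNReal.toReal_pos_iff.1 hZt).2.ne
  have hZ4_top : partitionFunction (d := 4) (L := 1) r.ρ (t / 4) ≠ ⊤ :=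
    (ENNReal.toReal_pos_iff.1 (partitionFunction_toReal_pos (d := 4) (L := 1) r.ρ r.continuous (t / 4))).2.ne
  have hR_top : (∫⁻ V, ENNReal.ofReal (Real.exp (-t * wilsonAction r.ρ V) * D V) ∂μ) ≠ ⊤ :=
    restrictedPF_ne_top (L := 1) r t ε'
  have hprod_top : ENNReal.ofReal (Real.exp (-(3 / 4 * (t * ε')))) * partitionFunction (d := 4) (L := 1) r.ρ (t / 4) ≠ ⊤ :=
    ENNReal.mul_ne_top ENNReal.ofReal_ne_top hZ4_top
  have hreal := ENNReal.toReal_mono (ENNReal.add_ne_top.2 ⟨hR_top, hprod_top⟩) hZ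
  rw [ENNReal.toReal_add hR_top hprod_top, ENNReal.toReal_mul, ENNReal.toReal_ofReal (Real.exp_pos _).le] at hreal
  -- `e^{−3tε'∕4}·Z₁(t∕4) ≤ e^{−log 2K}·K·Z₁(t) = ½ Z₁(t)`
  have hexp : Real.exp (-(3 / 4 * (t * ε'))) ≤ 1 / (2 * K) := by
    rw [show 1 / (2 * K) = Real.exp (-Real.log (2 * K)) by rw [Real.exp_neg, Real.exp_log (by linarith)]; ring]
    exact Real.exp_le_exp.2 (by nlinarith)
  have h4 := hKd t ht
  have hK0 : 0 < K := by linarith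
  have hhalf : Real.exp (-(3 / 4 * (t * ε'))) * (partitionFunction (d := 4) (L := 1) r.ρ (t / 4)).toReal ≤
      (partitionFunction (d := 4) (L := 1) r.ρ t).toReal / 2 := by
    calc Real.exp (-(3 / 4 * (t * ε'))) * (partitionFunction (d := 4) (L := 1) r.ρ (t / 4)).toReal
        ≤ 1 / (2 * K) * (K * (partitionFunction (d := 4) (L := 1) r.ρ t).toReal) :=
          mul_le_mul hexp h4 ENNReal.toReal_nonneg (by positivity)
      _ = (partitionFunction (d := 4) (L := 1) r.ρ t).toReal / 2 := by field_simp
  linarith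

end OneSite

end Summit.QuantumFields.YangMills.BalabanUVNodes.N20LCSRestrictedDoubling

end
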